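import Summits.CriticalPhenomena.Ising3DConformalLimit.Theses.MirrorHoelderCompactness
import Summits.CriticalPhenomena.Ising3DConformalLimit.Theses.MonotoneBlocking
import Summits.CriticalPhenomena.Ising3DConformalLimit.Theses.HyperoctahedralRP
import Summits.CriticalPhenomena.Ising3DConformalLimit.Theorems.HyperoctahedralRPHRP2Rigidity
import Summits.CriticalPhenomena.Ising3DConformalLimit.Theorems.HyperoctahedralRPLimitRotationInvariant
import Summits.CriticalPhenomena.Ising3DConformalLimit.Theorems.MoebiusLimitExists.Negative.FreeTranslations
import Literature.Probability.LatticeModels.PointwiseScalingLimitScaleCovariant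
import HarnessLib

/-!
# Crux `LimitsAreConformal` (stmt-CriticalPhenomena-6154) — line `hub-conjuncts` (crux-strategist, ALT to `birth`)

Strategist seat `planner-cstrat-stmt-CriticalPhenomena-6154-b1-0`, 2026-08-17, published as
`Cruxes/LimitsAreConformal/Lines/hub_conjuncts.lean`.

LEAD OWNERSHIP (line lead `prover-line-stmt-CriticalPhenomena-6154-0`, 2026-08-17): PICKED this line (PICKED.md);
this copy is the lead's skeleton `work/LimitsAreConformal.lean`, re-registered with `ledger skeleton check`. Stub set
unchanged: `stub_inversionUpgradeNormalised` (= item 1982) and `stub_nonGaussian` (= item 0636), both OPEN hub items with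
their own seated chains; the glue `LimitsAreConformal_of_subs(_expanded)` is landed separately at
`Theorems/MonotoneBlockingLimitsAreConformalSplit.lean` (`--supports stmt-CriticalPhenomena-6154`).

THE LINE. Conjunct (i) (rotation invariance) is a theorem of the tree (items 1979 + 1980). The two registered
stubs are the two HUB items of the sub-problem, VERBATIM:

* `stub_inversionUpgradeNormalised` = item stmt-CriticalPhenomena-1982 (`HyperoctahedralRP.InversionUpgradeNormalised`,
  12 routes; live line `free-endpoint-gaussian-closure`, zero-slack lattice form `InversionUpgradeNormalised_iff_latticeOneSided`,
  bridge from stmt-4840) — conjunct (ii);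
* `stub_nonGaussian` = item stmt-CriticalPhenomena-0636 (`HyperoctahedralRP.IsingEuclidUpgradeR4NonGaussian`, 31 routes;
  live line `isotherm-saturation-lee-yang`, exact factorisation `eta-free-split` = 5354 ∧ 2601) — conjunct (iii).

WHY THIS CUT (and not `birth` = 1982 + 2600 + 2601): it has ZERO SLACK. `LimitsAreConformal_iff_stubs` below is the
kernel-checked equivalence `LAC ↔ stub₁ ∧ stub₂`: item 0636 carries fewer hypotheses than conjunct (iii) of the crux
(no normalisation / translation invariance / scale covariance), but all three are AUTOMATIC for a non-degenerate
pointwise limit of `criticalCorr 3` (normalise `S·𝟙_{NC}`; `isTranslationInvariant_normalised_of_limit`;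
`HasPointwiseScalingLimit.exists_rpow_scale`), so nothing is lost; whereas `birth`'s stub 2 (`EtaPositive`, 2600, power-form
`η > 0` on the lattice) is strictly STRONGER than what (iii) needs (the exact residue is 5354-form `Δ > 1/2 for every
limit`, `twoPointPowerLawEta_iff_half_lt_delta`). Consequence for staffing: the crux should not hold a lead of its own —
it is the conjunction of two items that each have a standing disprover, lines and leads (see `Lines/hub_conjuncts.md` and
the STRATEGY-CENSUS); the typed split `LimitsAreConformal_of` is filed on route MonotoneBlocking (D-0019 glued split).

Composition: `LimitsAreConformal_of : Sig.stub_inversionUpgradeNormalised → Sig.stub_nonGaussian → LimitsAreConformal`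
(sorry-free; concludes `Theses.MirrorHoelderCompactness.LimitsAreConformal` BY NAME — the registered crux decl; the
`MonotoneBlocking` spelling is the same term, `monotoneBlocking_iff_mirror`). `LimitsAreConformal_of_stubs` closes the
crux modulo exactly the two stubs. The ONLY `sorry`s of this file are the two `stub_*`.

Disproof used: no `Disproof.lean` exists for stmt-6154 (crux dir: Lines/birth.*, Vetting.lean). Honoured: the refuter's
`Vetting.lean` (`limitsAreConformal_iff_exists_imp_summit`: LAC ↔ (ExistsScaleCovariantLimit → Ising3DConformalLimit);
`limits_proportional`: no junk instance) — both stubs keep the `HasPointwiseScalingLimit (criticalCorr 3)` hypothesis; item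
1982's `Theorems/InversionUpgradeNormalised/Negative/LoadBearingHypotheses.lean` (normalisation, scale covariance, Ising
limit each load-bearing: stub 1 is the item verbatim); item 0636's `Cruxes/IsingEuclidUpgradeR4NonGaussian/Disproof.lean`
(`false_without_nondegeneracy`, `false_without_latticeClause`: stub 2 is the item verbatim, both hypotheses kept).
-/

noncomputable section

namespace Summit.CriticalPhenomena.Ising3DConformalLimit.Cruxes.LimitsAreConformal.HubConjuncts

open Literature.Probability.LatticeModels
open Summit.CriticalPhenomena.Ising3DConformalLimit.Theses

/-! ## §1 Stub statements as named propositions (verbatim ledger signatures of items 1982 / 0636) -/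

/-- Statement of `stub_inversionUpgradeNormalised` = item stmt-CriticalPhenomena-1982 verbatim. -/
def Sig.stub_inversionUpgradeNormalised : Prop :=
  ∀ (ρ : ℝ → ℝ) (Δ : ℝ) (S : Literature.Probability.LatticeModels.CorrFamily 3), (∀ δ ∈ Set.Ioc (0:ℝ) 1, 0 < ρ δ)
  → Literature.Probability.LatticeModels.HasPointwiseScalingLimit (Literature.Probability.LatticeModels.criticalCorr 3) ρ S
  → (∀ n z, z ∉ Literature.Probability.LatticeModels.NonCoincident 3 n → S n z = 0)
  → Literature.Probability.LatticeModels.IsNondegenerateTwoPoint S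
  → Literature.Probability.LatticeModels.IsEuclideanInvariant S
  → Literature.Probability.LatticeModels.IsScaleCovariant Δ S
  → Literature.Probability.LatticeModels.IsInversionCovariant Δ S

/-- Statement of `stub_nonGaussian` = item stmt-CriticalPhenomena-0636 verbatim. -/
def Sig.stub_nonGaussian : Prop :=
  ∀ (ρ : ℝ → ℝ) (S : Literature.Probability.LatticeModels.CorrFamily 3), (∀ δ ∈ Set.Ioc (0:ℝ) 1, 0 < ρ δ)
  → Literature.Probability.LatticeModels.HasPointwiseScalingLimit (Literature.Probability.LatticeModels.criticalCorr 3) ρ S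
  → Literature.Probability.LatticeModels.IsNondegenerateTwoPoint S
  → Literature.Probability.LatticeModels.HasNontrivialU4 S

/-! ## §2 Registered stubs (the ONLY `sorry`s of this file) -/

/-- **Stub 1 (conjunct (ii); = item stmt-CriticalPhenomena-1982).** Every normalised, non-degenerate, Euclidean-invariant,
scale-covariant (weight `Δ`) pointwise scaling limit of `criticalCorr 3` (`ρ > 0` on `(0,1]`) is inversion covariant with
the same `Δ`. Open: the n ≥ 4 Möbius covariance of the interacting Ising₃ limit (zero-slack lattice form C ∧ D,
`InversionUpgradeNormalised_iff_latticeOneSided`; implied by stmt-4840). -/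
theorem stub_inversionUpgradeNormalised :
    ∀ (ρ : ℝ → ℝ) (Δ : ℝ) (S : Literature.Probability.LatticeModels.CorrFamily 3), (∀ δ ∈ Set.Ioc (0:ℝ) 1, 0 < ρ δ)
    → Literature.Probability.LatticeModels.HasPointwiseScalingLimit (Literature.Probability.LatticeModels.criticalCorr 3) ρ S
    → (∀ n z, z ∉ Literature.Probability.LatticeModels.NonCoincident 3 n → S n z = 0)
    → Literature.Probability.LatticeModels.IsNondegenerateTwoPoint S
    → Literature.Probability.LatticeModels.IsEuclideanInvariant S
    → Literature.Probability.LatticeModels.IsScaleCovariant Δ S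
    → Literature.Probability.LatticeModels.IsInversionCovariant Δ S := by
  sorry

/-- **Stub 2 (conjunct (iii); = item stmt-CriticalPhenomena-0636).** Every non-degenerate pointwise scaling limit of
`criticalCorr 3` (`ρ > 0` on `(0,1]`) has `U₄ ≢ 0` on non-coincident quadruples. Open: non-triviality of critical
Ising₃ (exactly: `Δ > 1/2` for every limit [5354] ∧ a Gaussian limit is free [2601], `eta-free-split`). -/
theorem stub_nonGaussian :
    ∀ (ρ : ℝ → ℝ) (S : Literature.Probability.LatticeModels.CorrFamily 3), (∀ δ ∈ Set.Ioc (0:ℝ) 1, 0 < ρ δ)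
    → Literature.Probability.LatticeModels.HasPointwiseScalingLimit (Literature.Probability.LatticeModels.criticalCorr 3) ρ S
    → Literature.Probability.LatticeModels.IsNondegenerateTwoPoint S
    → Literature.Probability.LatticeModels.HasNontrivialU4 S := by
  sorry

/-! ## §3 The stubs ARE the hub items (kernel-checked identities) -/

theorem sig_inversionUpgradeNormalised_iff_item1982 :
    Sig.stub_inversionUpgradeNormalised ↔ HyperoctahedralRP.InversionUpgradeNormalised :=
  Iff.rfl

theorem sig_nonGaussian_iff_item0636 :
    Sig.stub_nonGaussian ↔ HyperoctahedralRP.IsingEuclidUpgradeR4NonGaussian :=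
  Iff.rfl

/-- The two route spellings of the crux are one term. -/
theorem monotoneBlocking_iff_mirror :
    MonotoneBlocking.LimitsAreConformal ↔ MirrorHoelderCompactness.LimitsAreConformal :=
  Iff.rfl

/-! ## §4 Landed input: conjunct (i) -/

/-- **Conjunct (i) is a theorem of the tree** (items 1979 `HRP2Rigidity_of` + 1980 `limitRotationInvariant_proof`). -/
theorem isRotationInvariant_of_hypotheses {ρ : ℝ → ℝ} {Δ : ℝ} {S : CorrFamily 3}
    (hρ : ∀ δ ∈ Set.Ioc (0:ℝ) 1, 0 < ρ δ) (hlim : HasPointwiseScalingLimit (criticalCorr 3) ρ S)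
    (hnorm : ∀ n z, z ∉ NonCoincident 3 n → S n z = 0) (hnd : IsNondegenerateTwoPoint S)
    (htr : IsTranslationInvariant S) (hsc : IsScaleCovariant Δ S) : IsRotationInvariant S :=
  Summit.CriticalPhenomena.Ising3DConformalLimit.Cruxes.LimitRotationInvariant.QuarterTurnLiouville.limitRotationInvariant_proof
    Summit.CriticalPhenomena.Ising3DConformalLimit.Cruxes.HRP2Rigidity.XRayMellin.HRP2Rigidity_of
    ρ Δ S hρ hlim hnorm hnd htr hsc

/-! ## §5 Composition — the crux BY NAME from the two stubs (sorry-free) -/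

/-- **COMPOSITION.** `Sig.stub_inversionUpgradeNormalised → Sig.stub_nonGaussian → LimitsAreConformal`: (i) landed rotation
invariance gives Euclidean invariance `⟨transl, rot⟩`; (ii) is stub 1 fed with it; (iii) is stub 2 (which needs only `ρ > 0`,
the limit and non-degeneracy). Concludes `Theses.MirrorHoelderCompactness.LimitsAreConformal` by name. -/
theorem LimitsAreConformal_of :
    Sig.stub_inversionUpgradeNormalised → Sig.stub_nonGaussian →
      Summit.CriticalPhenomena.Ising3DConformalLimit.Theses.MirrorHoelderCompactness.LimitsAreConformal := by
  intro hInv hNG ρ Δ S hρ hlim hnorm hnd htr hsc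
  have hrot : IsRotationInvariant S := isRotationInvariant_of_hypotheses hρ hlim hnorm hnd htr hsc
  exact ⟨hrot, hInv ρ Δ S hρ hlim hnorm hnd ⟨htr, hrot⟩ hsc, hNG ρ S hρ hlim hnd⟩

/-- The same composition concluding the `MonotoneBlocking` spelling by name. -/
theorem LimitsAreConformal_of_monotoneBlocking :
    Sig.stub_inversionUpgradeNormalised → Sig.stub_nonGaussian →
      Summit.CriticalPhenomena.Ising3DConformalLimit.Theses.MonotoneBlocking.LimitsAreConformal :=
  LimitsAreConformal_of

/-- The crux from the registered stubs (closed modulo exactly `stub_inversionUpgradeNormalised`, `stub_nonGaussian`). -/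
theorem LimitsAreConformal_of_stubs :
    Summit.CriticalPhenomena.Ising3DConformalLimit.Theses.MirrorHoelderCompactness.LimitsAreConformal :=
  LimitsAreConformal_of stub_inversionUpgradeNormalised stub_nonGaussian

/-! ## §6 ZERO SLACK — the converses (crux ⟹ each stub), sorry-free -/

/-- **LAC ⟹ stub 1** (Euclidean invariance is a stronger hypothesis than translation invariance). -/
theorem stub_inversionUpgradeNormalised_of_crux
    (h : Summit.CriticalPhenomena.Ising3DConformalLimit.Theses.MirrorHoelderCompactness.LimitsAreConformal) :
    Sig.stub_inversionUpgradeNormalised := by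
  intro ρ Δ S hρ hlim hnorm hnd heuc hsc
  exact (h ρ Δ S hρ hlim hnorm hnd heuc.1 hsc).2.1

theorem injective_vec2 {α : Type*} {a b : α} (h : a ≠ b) : Function.Injective ![a, b] := by
  intro i j hij
  fin_cases i <;> fin_cases j <;> simp_all

/-- `U₄` of two families that agree on non-coincident pairs and quadruples agree on non-coincident quadruples. -/
theorem limitConnectedFour_congr {S S' : CorrFamily 3}
    (h2 : ∀ z ∈ NonCoincident 3 2, S' 2 z = S 2 z) (h4 : ∀ z ∈ NonCoincident 3 4, S' 4 z = S 4 z)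
    {x : Fin 4 → EuclideanSpace ℝ (Fin 3)} (hx : x ∈ NonCoincident 3 4) :
    limitConnectedFour S' x = limitConnectedFour S x := by
  have hinj : Function.Injective x := hx
  have hp : ∀ i j : Fin 4, i ≠ j → S' 2 ![x i, x j] = S 2 ![x i, x j] :=
    fun i j hij => h2 _ (injective_vec2 (hinj.ne hij))
  simp only [limitConnectedFour]
  rw [h4 x hx, hp 0 1 (by decide), hp 2 3 (by decide), hp 0 2 (by decide),
    hp 1 3 (by decide), hp 0 3 (by decide), hp 1 2 (by decide)]

open Classical in
/-- **LAC ⟹ stub 2.** For a non-degenerate pointwise limit `S` (any `ρ > 0`) the normalisation `S·𝟙_{NC}` is again a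
limit, normalised, non-degenerate, translation invariant (automatic, `isTranslationInvariant_normalised_of_limit`) and
scale covariant with the automatic dimension of `exists_rpow_scale`; the crux gives `HasNontrivialU4` for it; `U₄` is read
on non-coincident quadruples only. -/
theorem stub_nonGaussian_of_crux
    (h : Summit.CriticalPhenomena.Ising3DConformalLimit.Theses.MirrorHoelderCompactness.LimitsAreConformal) :
    Sig.stub_nonGaussian := by
  intro ρ S hρ hlim hnd
  obtain ⟨Δ, -, hcov⟩ := hlim.exists_rpow_scale (by norm_num) hρ hnd
  set S' : CorrFamily 3 := fun n x => if x ∈ NonCoincident 3 n then S n x else 0 with hS'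
  have S'_mem : ∀ {n : ℕ} {z : Fin n → EuclideanSpace ℝ (Fin 3)}, z ∈ NonCoincident 3 n →
      S' n z = S n z := fun hz => by simp only [hS', if_pos hz]
  have S'_nmem : ∀ {n : ℕ} {z : Fin n → EuclideanSpace ℝ (Fin 3)}, z ∉ NonCoincident 3 n →
      S' n z = 0 := fun hz => by simp only [hS', if_neg hz]
  have hlim' : HasPointwiseScalingLimit (criticalCorr 3) ρ S' :=
    fun n => (hlim n).congr_right fun z hz => (S'_mem hz).symm
  have hnorm' : ∀ n z, z ∉ NonCoincident 3 n → S' n z = 0 := fun n z hz => S'_nmem hz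
  have hnd' : IsNondegenerateTwoPoint S' := fun z hz => by rw [S'_mem hz]; exact hnd z hz
  have htr' : IsTranslationInvariant S' :=
    Summit.CriticalPhenomena.Ising3DConformalLimit.MoebiusLimitExistsNegative.isTranslationInvariant_normalised_of_limit
      hlim
  have hsc' : IsScaleCovariant Δ S' := by
    intro n c hc z
    by_cases hz : z ∈ NonCoincident 3 n
    · have hz' : (fun i => c • z i) ∈ NonCoincident 3 n := smul_mem_nonCoincident hc.ne' hz
      rw [S'_mem hz', S'_mem hz]
      exact hcov n c hc z hz
    · have hz' : (fun i => c • z i) ∉ NonCoincident 3 n := fun h' =>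
        hz ((smul_right_injective (EuclideanSpace ℝ (Fin 3)) hc.ne').of_comp_iff z |>.1 h')
      rw [S'_nmem hz', S'_nmem hz, mul_zero]
  obtain ⟨-, -, x, hx, hne⟩ := h ρ Δ S' hρ hlim' hnorm' hnd' htr' hsc'
  refine ⟨x, hx, ?_⟩
  rwa [limitConnectedFour_congr (S := S) (S' := S') (fun z hz => S'_mem hz) (fun z hz => S'_mem hz) hx]
    at hne

/-- **ZERO SLACK.** The crux is exactly the conjunction of its two stubs (= items 1982 ∧ 0636). -/
theorem LimitsAreConformal_iff_stubs :
    Summit.CriticalPhenomena.Ising3DConformalLimit.Theses.MirrorHoelderCompactness.LimitsAreConformal ↔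
      (Sig.stub_inversionUpgradeNormalised ∧ Sig.stub_nonGaussian) :=
  ⟨fun h => ⟨stub_inversionUpgradeNormalised_of_crux h, stub_nonGaussian_of_crux h⟩,
    fun h => LimitsAreConformal_of h.1 h.2⟩

end Summit.CriticalPhenomena.Ising3DConformalLimit.Cruxes.LimitsAreConformal.HubConjuncts

end
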